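import Literature.Computability.Cryptography.LayeredTriangleGraph
import Literature.Computability.Cryptography.GraphPathProblemsBounds
import HarnessLib

/-!
# The product layered graph: a distance product as one APSP instance

The combinatorial core of the reduction distance product `≤₃` APSP (Vassilevska Williams–Williams,
J. ACM 65 (2018), proof of Thm. 5.1, p. 27:22): given `n × n` matrices `A, B` over `ℤ ∪ {∞}`,
"consider the edge-weighted … tripartite graph `G` with `n`-node partitions `I, J, K` such that there
are no edges between `I` and `K`, and for all `i ∈ I, j ∈ J, k ∈ K`, `(i, j)` and `(j, k)` are edges
with `w(i, j) = A[i, j]` … and `w(j, k) = B[j, k]` …" (in print `+ 6M`, to keep the undirected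
instance nonnegative); then an APSP computation on `G` finds "for every two nodes `i ∈ I, k ∈ K`,
the shortest path between `i` and `k` using exactly two edges, thus computing the `(min,+)` product
of `A` and `B`". For *directed* APSP (the zoo problem `APSP c` of
`Literature.Computability.Cryptography.FGProblemZoo`) the layered digraph is acyclic and no weight
shift is needed:

* `productLayeredGraph A B` on `Fin (3 * n)` (vertex `Fin.mkDivMod ℓ a` = copy `ℓ ∈ {0, 1, 2}` of
  `a : Fin n`, so `u.divNat` is the layer `I, J, K` and `u.modNat` the original index): an arc of
  weight `A i j` from copy `0` of `i` to copy `1` of `j`, an arc of weight `B j k` from copy `1` of `j`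
  to copy `2` of `k`, and no other arcs (`⊤`);
* it is levelled by the layer, hence has no negative cycle
  (`hasNoNegativeCycle_productLayeredGraph`, from `hasNoNegativeCycle_of_levels` of
  `Literature.Computability.Cryptography.LayeredTriangleGraph`), and its weights are those of `A`
  and `B` (`hasBoundedWeights_productLayeredGraph`), so it is an `APSP c` instance of size `3 n`
  whenever `(A, B)` is a `MinPlusProduct c` instance (`productLayeredGraph_mem_APSP`);
* **`shortestDist_productLayeredGraph`**: the distance from copy `0` of `i` to copy `2` of `k` is
  `minPlusProduct A B i k` (upper bound through the two-arc walks via copy `1` of each `j`;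
  conversely a finite optimum decomposes, by last-edge extraction, into an arc from layer `1` and an
  arc from layer `0` issued at copy `0` of `i` itself, since finite optima only go up in level).

Everything here is proved.

## References

* V. Vassilevska Williams, R. R. Williams, *Subcubic equivalences between path, matrix, and triangle
  problems*, J. ACM 65 (2018), Art. 27, proof of Thm. 5.1 (p. 27:22); §4 p. 27:13 (weight ranges).
  doi:10.1145/3186893
* T. H. Cormen, C. E. Leiserson, R. L. Rivest, C. Stein, *Introduction to Algorithms*, 3rd ed.,
  §25.1 (the `(min,+)` recurrence) and §24.2 (shortest paths in DAGs).
-/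

namespace Literature.Computability.Cryptography

open Matrix Tropical

section Product

variable {n : ℕ}

/-- **The product layered graph** of two `n × n` weight matrices `A, B` (VW–W 2018, proof of
Thm. 5.1, p. 27:22, directed and unshifted): vertex set `Fin (3 * n)`, vertex `Fin.mkDivMod ℓ a`
being copy `ℓ ∈ {0, 1, 2}` (the parts `I, J, K`) of `a : Fin n`; an arc of weight `A i j` from copy
`0` of `i` to copy `1` of `j`, an arc of weight `B j k` from copy `1` of `j` to copy `2` of `k`, and
`⊤` (no arc) otherwise — in particular no arcs between `I` and `K`.
[cite: VassilevskaWilliamsWilliams2018, proof of Thm. 5.1 (p. 27:22)] -/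
def productLayeredGraph (A B : Matrix (Fin n) (Fin n) (WithTop ℤ)) :
    Matrix (Fin (3 * n)) (Fin (3 * n)) (WithTop ℤ) :=
  Matrix.of fun u v =>
    if (u.divNat : ℕ) = 0 ∧ (v.divNat : ℕ) = 1 then A u.modNat v.modNat
    else if (u.divNat : ℕ) = 1 ∧ (v.divNat : ℕ) = 2 then B u.modNat v.modNat
    else ⊤

variable (A B : Matrix (Fin n) (Fin n) (WithTop ℤ))

/-- Entries of the product layered graph (definition unfolding). [folklore] -/
theorem productLayeredGraph_apply (u v : Fin (3 * n)) :
    productLayeredGraph A B u v =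
      if (u.divNat : ℕ) = 0 ∧ (v.divNat : ℕ) = 1 then A u.modNat v.modNat
      else if (u.divNat : ℕ) = 1 ∧ (v.divNat : ℕ) = 2 then B u.modNat v.modNat
      else ⊤ :=
  rfl

/-- An arc of the product layered graph goes from layer `0` to layer `1` carrying an entry of `A`, or
from layer `1` to layer `2` carrying an entry of `B`. [folklore] -/
theorem productLayeredGraph_ne_top {u v : Fin (3 * n)} (h : productLayeredGraph A B u v ≠ ⊤) :
    ((u.divNat : ℕ) = 0 ∧ (v.divNat : ℕ) = 1 ∧
        productLayeredGraph A B u v = A u.modNat v.modNat) ∨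
      ((u.divNat : ℕ) = 1 ∧ (v.divNat : ℕ) = 2 ∧
        productLayeredGraph A B u v = B u.modNat v.modNat) := by
  rw [productLayeredGraph_apply] at h ⊢
  by_cases h1 : (u.divNat : ℕ) = 0 ∧ (v.divNat : ℕ) = 1
  · exact Or.inl ⟨h1.1, h1.2, if_pos h1⟩
  · rw [if_neg h1] at h ⊢
    by_cases h2 : (u.divNat : ℕ) = 1 ∧ (v.divNat : ℕ) = 2
    · exact Or.inr ⟨h2.1, h2.2, if_pos h2⟩
    · rw [if_neg h2] at h
      exact absurd rfl h

/-- The product layered graph is levelled by the layer `u.divNat`: every arc goes up. [folklore] -/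
theorem productLayeredGraph_levels (u v : Fin (3 * n)) (h : productLayeredGraph A B u v ≠ ⊤) :
    (u.divNat : ℕ) < v.divNat := by
  rcases productLayeredGraph_ne_top A B h with ⟨hu, hv, -⟩ | ⟨hu, hv, -⟩ <;> omega

/-- **The product layered graph has no negative cycle** (it is acyclic), so it is a legitimate APSP
instance. [folklore] -/
theorem hasNoNegativeCycle_productLayeredGraph : HasNoNegativeCycle (productLayeredGraph A B) :=
  hasNoNegativeCycle_of_levels _ (fun u => (u.divNat : ℕ)) (productLayeredGraph_levels A B)

/-- **The product layered graph has the weights of `A` and `B`**: if both have `M`-bounded entries,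
so does the graph. [folklore] -/
theorem hasBoundedWeights_productLayeredGraph {M : ℕ} (hA : HasBoundedWeights A M)
    (hB : HasBoundedWeights B M) : HasBoundedWeights (productLayeredGraph A B) M := by
  intro u v
  rw [productLayeredGraph_apply]
  split_ifs
  · exact hA _ _
  · exact hB _ _
  · exact Or.inl rfl

/-- **The product layered graph of a `MinPlusProduct c` instance is an `APSP c` instance** of size
`3 n`: weights bounded by `n ^ c ≤ (3 n) ^ c`, no negative cycle. [folklore] -/
theorem productLayeredGraph_mem_APSP (c : ℕ) (hA : HasBoundedWeights A (n ^ c))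
    (hB : HasBoundedWeights B (n ^ c)) :
    HasBoundedWeights (productLayeredGraph A B) ((3 * n) ^ c) ∧
      HasNoNegativeCycle (productLayeredGraph A B) :=
  ⟨fun u v => IsBddWeight.mono (hasBoundedWeights_productLayeredGraph A B hA hB u v)
      (Nat.pow_le_pow_left (by omega) c),
    hasNoNegativeCycle_productLayeredGraph A B⟩

/-- The arc from copy `0` of `i` to copy `1` of `j` has weight `A i j`. [folklore] -/
theorem productLayeredGraph_arcA (i j : Fin n) :
    productLayeredGraph A B (Fin.mkDivMod 0 i) (Fin.mkDivMod 1 j) = A i j := by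
  rw [productLayeredGraph_apply, if_pos] <;> simp

/-- The arc from copy `1` of `j` to copy `2` of `k` has weight `B j k`. [folklore] -/
theorem productLayeredGraph_arcB (j k : Fin n) :
    productLayeredGraph A B (Fin.mkDivMod 1 j) (Fin.mkDivMod 2 k) = B j k := by
  rw [productLayeredGraph_apply, if_neg, if_pos] <;> simp

/-- **Upper bound**: the distance from copy `0` of `i` to copy `2` of `k` is at most `A i j + B j k`
for every `j` (the two-arc walk through copy `1` of `j`). [folklore] -/
theorem shortestDist_productLayeredGraph_le (i j k : Fin n) :
    shortestDist (productLayeredGraph A B) (Fin.mkDivMod 0 i) (Fin.mkDivMod 2 k) ≤ A i j + B j k := by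
  set G := productLayeredGraph A B with hG
  have hn : 2 ≤ Fintype.card (Fin (3 * n)) := by
    rw [Fintype.card_fin]
    have := i.pos
    omega
  have h1 : walkDistLE G 1 (Fin.mkDivMod 0 i) (Fin.mkDivMod 1 j) ≤ A i j := by
    refine (walkDistLE_succ_le_add G 0 _ (Fin.mkDivMod 0 i) _).trans ?_
    rw [walkDistLE_zero_apply, if_pos rfl, zero_add, hG, productLayeredGraph_arcA]
  have h2 : walkDistLE G 2 (Fin.mkDivMod 0 i) (Fin.mkDivMod 2 k) ≤ A i j + B j k := by
    refine (walkDistLE_succ_le_add G 1 _ (Fin.mkDivMod 1 j) _).trans ?_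
    rw [hG, productLayeredGraph_arcB]
    exact add_le_add h1 le_rfl
  exact (shortestDist_le_of_le_holds G hn _ _).trans h2

/-- The distance from copy `0` of `i` to copy `2` of `k` is at most `minPlusProduct A B i k`.
[folklore] -/
theorem shortestDist_productLayeredGraph_le_minPlusProduct (i k : Fin n) :
    shortestDist (productLayeredGraph A B) (Fin.mkDivMod 0 i) (Fin.mkDivMod 2 k) ≤
      minPlusProduct A B i k := by
  rw [minPlusProduct_apply]
  exact Finset.le_inf fun j _ => shortestDist_productLayeredGraph_le A B i j k

/-- **Extraction**: a finite distance from copy `0` of `i` to copy `2` of `k` is `A i j + B j k` for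
some `j` (peel off the last two arcs; the remaining finite optimum stays in layer `0`, hence at copy
`0` of `i` with value `0`). [folklore] -/
theorem exists_of_shortestDist_productLayeredGraph_ne_top (i k : Fin n)
    (h : shortestDist (productLayeredGraph A B) (Fin.mkDivMod 0 i) (Fin.mkDivMod 2 k) ≠ ⊤) :
    ∃ j, shortestDist (productLayeredGraph A B) (Fin.mkDivMod 0 i) (Fin.mkDivMod 2 k) =
      A i j + B j k := by
  set s := Fin.mkDivMod (0 : Fin 3) i with hs
  set t := Fin.mkDivMod (2 : Fin 3) k with ht
  have hlev := productLayeredGraph_levels A B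
  have hsd : (s.divNat : ℕ) = 0 := by simp [hs]
  have htd : (t.divNat : ℕ) = 2 := by simp [ht]
  have hsm : s.modNat = i := by simp [hs]
  have htm : t.modNat = k := by simp [ht]
  have hst : s ≠ t := fun h' => by
    have h'' := congrArg (fun u : Fin (3 * n) => (u.divNat : ℕ)) h'
    simp only [hsd, htd] at h''
    omega
  -- last arc: `l₂ → t`, necessarily from layer `1`
  obtain ⟨k₂, -, l₂, he₂, hf₂, ha₂⟩ :=
    exists_last_edge_of_walkDistLE_ne_top (productLayeredGraph A B) h hst
  rcases productLayeredGraph_ne_top A B ha₂ with ⟨-, ht₂, -⟩ | ⟨hl₂, -, hw₂⟩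
  · exfalso
    rw [htd] at ht₂
    omega
  have hsl₂ : s ≠ l₂ := fun h' => by
    have h'' := congrArg (fun u : Fin (3 * n) => (u.divNat : ℕ)) h'
    simp only [hsd, hl₂] at h''
    omega
  -- middle arc: `l₁ → l₂`, necessarily from layer `0`
  obtain ⟨k₁, -, l₁, he₁, hf₁, ha₁⟩ :=
    exists_last_edge_of_walkDistLE_ne_top (productLayeredGraph A B) hf₂ hsl₂
  rcases productLayeredGraph_ne_top A B ha₁ with ⟨hl₁, -, hw₁⟩ | ⟨-, hm₁, -⟩
  swap
  · exfalso
    rw [hl₂] at hm₁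
    omega
  -- the remaining finite optimum stays in layer `0`, hence `l₁ = s`
  have hl₁s : l₁ = s := by
    rcases eq_or_lt_of_walkDistLE_ne_top (productLayeredGraph A B) (fun u => (u.divNat : ℕ)) hlev
        k₁ s l₁ hf₁ with h' | h'
    · exact h'.symm
    · exfalso
      simp only [hsd, hl₁] at h'
      omega
  subst hl₁s
  have h0 : walkDistLE (productLayeredGraph A B) k₁ s s = 0 :=
    walkDistLE_self_of_levels (productLayeredGraph A B) (fun u => (u.divNat : ℕ)) hlev k₁ s
  refine ⟨l₂.modNat, ?_⟩
  change walkDistLE (productLayeredGraph A B) _ s t = _ at he₂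
  change walkDistLE (productLayeredGraph A B) _ s t = _
  rw [he₂, he₁, h0, zero_add, hw₁, hw₂, hsm, htm]

/-- **The distance product as one APSP instance** (VW–W 2018, proof of Thm. 5.1, p. 27:22: the
shortest `i`–`k` paths "using exactly two edges" compute "the `(min,+)` product of `A` and `B`"): in
the product layered graph, the distance from copy `0` of `i` to copy `2` of `k` is
`minPlusProduct A B i k`. [cite: VassilevskaWilliamsWilliams2018, proof of Thm. 5.1 (p. 27:22)] -/
theorem shortestDist_productLayeredGraph (i k : Fin n) :
    shortestDist (productLayeredGraph A B) (Fin.mkDivMod 0 i) (Fin.mkDivMod 2 k) =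
      minPlusProduct A B i k := by
  refine le_antisymm (shortestDist_productLayeredGraph_le_minPlusProduct A B i k) ?_
  by_cases h : shortestDist (productLayeredGraph A B) (Fin.mkDivMod 0 i) (Fin.mkDivMod 2 k) = ⊤
  · rw [h]
    exact le_top
  · obtain ⟨j, hj⟩ := exists_of_shortestDist_productLayeredGraph_ne_top A B i k h
    rw [hj, minPlusProduct_apply]
    exact Finset.inf_le (Finset.mem_univ j)

/-- The entries of the distance matrix of the product layered graph of `M`-bounded `A, B` are
`3 n · M`-bounded. (Every finite optimum uses at most two arcs, so the `I`–`K` entries are in fact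
`2 M`-bounded, via `shortestDist_productLayeredGraph` and `hasBoundedWeights_minPlusProduct`; we only
record the general walk bound `3 n · M` of `hasBoundedWeights_shortestDist`, which suffices for
word-representability.) [folklore] -/
theorem hasBoundedWeights_shortestDist_productLayeredGraph {M : ℕ} (hA : HasBoundedWeights A M)
    (hB : HasBoundedWeights B M) :
    HasBoundedWeights (shortestDist (productLayeredGraph A B)) (3 * n * M) := by
  have := hasBoundedWeights_shortestDist (hasBoundedWeights_productLayeredGraph A B hA hB)
  rwa [Fintype.card_fin] at this

end Product

end Literature.Computability.Cryptography
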